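import Literature.Analysis.FluidPDE.HardSphereEuclideanTransfer
import Literature.Analysis.FluidPDE.HardSphereAlexander
import HarnessLib

/-!
# Alexander's theorem and Liouville's theorem for hard spheres in `ℝ^d`

Last layer of the proof of **Alexander's theorem in `ℝ^d`**: discharge of the named fact
`Literature.Analysis.FluidPDE.HardSphereFlow.nonempty` of `HardSphereDynamics`
(`HardSphereFlow.nonempty_holds`): for every `ε > 0` and every `N`, the hypothesis structure
`HardSphereFlow (Euclidean.geometry d) ε N` — an a.e. defined, measurable, Liouville-preserving
group of hard-sphere trajectories on `(ℝ^d × ℝ^d)^N` — is inhabited, by the collision-by-collision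
flow `Alexander.flow (Euclidean.geometry d) ε` with good set `Alexander.good` of
`HardSphereFlowConstruction` (Alexander 1975; Gallagher–Saint-Raymond–Texier 2013 Prop. 4.1.1,
stated in `ℝ^{2dN}`: "Let `N, ε` be fixed. The set of initial configurations leading to a
pathological trajectory is of measure zero in `ℝ^{2dN}`"; Cercignani–Illner–Pulvirenti 1994
Thm. 4.2.1 and App. 4.A, p. 111: "the cases of reflecting boundary conditions and `Λ = ℝ³` can be
treated similarly"). The deterministic fields (group law, orbits are trajectories) and
measurability are the generic theorems of `HardSphereFlowGroup`, `HardSphereFlowOrbits`,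
`HardSphereFlowMeasurable` for regular measurable geometries
(`Euclidean.isHardSphereRegular_geometry`, `Euclidean.isMeasurable_geometry`); the two
measure-theoretic fields are obtained here from the *torus* theorems
`Alexander.torusFlow_ae_good_holds` and `Alexander.torusFlow_measurePreserving_holds`
(`HardSphereAlexander`) through the transfer map `z ↦ P (L⁻¹ z)` of
`HardSphereEuclideanTransferDefs` / `…Scaling` / `…Transfer` (rescale by `L⁻¹`, project positions
to `T^d`). This is GST's proof scheme (balls `B_R^N × B_R^N`, horizons `t_n → ∞`, "the measure
is invariant by the flow") with the torus theorem as the local input: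

* **measure theory of the transfer map**: Lebesgue measure on `(ℝ^d × ℝ^d)^N` is an additive
  Haar measure (so rescaling by `L` multiplies volumes by `L^{2dN}`,
  `Measure.addHaar_preimage_smul`); the projection `projConfig` is measure preserving from the
  chart cube `((-1/2, 1/2]^d × ℝ^d)^N` onto the torus phase space and the lift `reprConfig` is
  measure preserving back (`Torus.map_proj_volume_restrict_symCube`,
  `Torus.measurePreserving_reprSym`, one particle at a time); hence
  `vol_E (K ∩ (P ∘ L⁻¹)⁻¹ S) ≤ L^{2dN} vol_T S` for `K` rescaled into the cube
  (`volume_inter_preimage_transfer_le`) and `vol_T (reprConfig⁻¹ Y) ≤ vol_E Y`;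
* **Alexander's theorem** (`Alexander.euclidFlow_ae_good`): on the box `{‖x_i‖, ‖v_i‖ ≤ R}`
  and for the horizon `T`, with `L > 4R(1 + (T+1)√N)` the rescaled data are chart-safe
  (`isChartSafe_smul_of_mem_phaseBox`), so a datum of the domain outside the truncated good set
  `goodUpTo T` is sent into the torus bad set, which is null
  (`euclid_volume_phaseBox_inter_diff_goodUpTo`); exhausting `R, T → ∞` (GST's
  `I = ⋃ₙ I(tₙ, Rₙ)`) the Euclidean bad set is null;
* **Liouville's theorem** (`Alexander.euclidFlow_measurePreserving`): for every real `s` and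
  measurable `B`, `vol (Γ₀ ∩ (T^s)⁻¹ B) ≤ vol B` — on boxes the orbits are carried to torus
  orbits (`IsChartSafe.projConfig_flow`, `flow_smul`; `euclid_transfer_orbit`) and the torus flow
  preserves the Liouville measure, the factors `L^{±2dN}` cancelling
  (`euclid_volume_good_inter_preimage_flow_box_le`) — and the group property on `Γ₀`
  (`HardSphereFlowGroup`) upgrades the inequalities at times `s` and `-s` to equality
  (`euclid_volume_good_inter_preimage_flow_eq`); since `Γ₀ᶜ` is null, `liouville = vol|_{Γ₀}`
  is invariant.

## Mathlib / Literature reuse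

`Measure.addHaar_preimage_smul`, `Measure.pi.isAddHaarMeasure`, `measurePreserving_pi`,
`MeasurePreserving.prod`, `Measure.restrict_pi_pi`, `Measure.prod_restrict`,
`Measure.le_map_apply`, `Monotone.measure_iUnion`, `Measure.restrict_congr_set`,
`MeasurePreserving.measure_preimage` are Mathlib's. The torus theorems, the group law
(`mapsTo_flow_good`, `flow_add_of_mem_good`, `flow_zero_of_mem_good`), the trajectories
(`isHardSphereTrajectory_flow`) and measurability (`measurableSet_good`, `measurable_flow`) are
the `HardSphere*` files'; the transfer is `HardSphereEuclideanTransfer`'s.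

## Design choices

* `IsAddHaarMeasure` for `volume` on `ℝ^d × ℝ^d` and on `(ℝ^d × ℝ^d)^N`, and `SigmaFinite` under
  a binder, are supplied by hand (instance search does not unfold `volume` on `X × Y` to
  `Measure.prod`): as *theorems* used with `haveI`, not as global instances.
* All volume comparisons are inequalities between outer measures of (pre)images, so that no
  measurability of images is ever needed (`Measure.le_map_apply`).

## References

* R. K. Alexander, *The infinite hard sphere system*, Ph.D. thesis, UC Berkeley (1975).
* I. Gallagher, L. Saint-Raymond, B. Texier, *From Newton to Boltzmann: hard spheres and
  short-range potentials*, EMS (2013), arXiv:1208.5753, §4.1, Prop. 4.1.1 and its proof,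
  Lemma 4.1.2 (p. 19; = Prop. 2.1.1, pp. 9–10 of the arXiv text, stated in `ℝ^{2dN}`).
* C. Cercignani, R. Illner, M. Pulvirenti, *The Mathematical Theory of Dilute Gases*, Springer
  (1994), §4.2 (Thm. 4.2.1, p. 65), App. 4.A pp. 107–111 (torus), p. 111 ("`Λ = ℝ³` similarly").
-/

open Set Filter Topology Function MeasureTheory Metric
open scoped ENNReal InnerProductSpace

namespace Literature.Analysis.FluidPDE

noncomputable section

/-! ## Measure theory of the transfer map -/

section MeasureTransfer

variable {d : Type*} [Fintype d] {N : ℕ}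

/-- Lebesgue measure on the one-particle phase space `ℝ^d × ℝ^d` is an additive Haar measure
(Mathlib's instance for `Measure.prod`, restated for `volume` on the product type, which
instance search does not unfold; a theorem, used locally with `haveI`). [folklore] -/
theorem Euclidean.isAddHaarMeasure_volume_phase :
    Measure.IsAddHaarMeasure (volume : Measure (EuclideanSpace ℝ d × EuclideanSpace ℝ d)) :=
  show Measure.IsAddHaarMeasure ((volume : Measure (EuclideanSpace ℝ d)).prod volume) from
    inferInstance

/-- Lebesgue measure on the `N`-particle phase space `(ℝ^d × ℝ^d)^N` is an additive Haar measure
(a theorem, used locally with `haveI`). [folklore] -/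
theorem Euclidean.isAddHaarMeasure_volume_config :
    Measure.IsAddHaarMeasure (volume : Measure (Config N d (EuclideanSpace ℝ d))) :=
  haveI := Euclidean.isAddHaarMeasure_volume_phase (d := d)
  show Measure.IsAddHaarMeasure (Measure.pi fun _ : Fin N =>
    (volume : Measure (EuclideanSpace ℝ d × EuclideanSpace ℝ d))) from Measure.pi.isAddHaarMeasure _

namespace Alexander

/-- A configuration with all positions of norm `< 1/2` lies in the chart cube. [folklore] -/
theorem mem_chartCube_of_norm_lt {z : Config N d (EuclideanSpace ℝ d)} (hz : ∀ i, ‖(z i).1‖ < 1 / 2) :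
    z ∈ chartCube N d := by
  intro i
  obtain ⟨r, hr, hr'⟩ := exists_between (hz i)
  exact Torus.closedBall_subset_symCube hr' (mem_closedBall_zero_iff.2 hr.le)

/-- Lebesgue measure restricted to the chart cube is a product of one-particle measures. [folklore] -/
theorem volume_restrict_chartCube :
    (volume : Measure (Config N d (EuclideanSpace ℝ d))).restrict (chartCube N d) =
      Measure.pi fun _ : Fin N =>
        ((volume : Measure (EuclideanSpace ℝ d)).restrict (Torus.symCube d)).prod
          (volume : Measure (EuclideanSpace ℝ d)) := by
  rw [chartCube_eq_pi, volume_pi, Measure.restrict_pi_pi]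
  congr 1
  funext i
  rw [Measure.volume_eq_prod, ← Measure.prod_restrict, Measure.restrict_univ]

/-- **The projection is measure preserving from the chart cube onto the torus phase space**
(`Torus.map_proj_volume_restrict_symCube`, one particle at a time). [folklore] -/
theorem measurePreserving_projConfig :
    MeasurePreserving (projConfig : Config N d (EuclideanSpace ℝ d) → Config N d (UnitAddTorus d))
      (volume.restrict (chartCube N d)) volume := by
  have h1 : MeasurePreserving
      (Prod.map (FunctionSpaces.Torus.proj : EuclideanSpace ℝ d → UnitAddTorus d) id)
      (((volume : Measure (EuclideanSpace ℝ d)).restrict (Torus.symCube d)).prod volume)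
      ((volume : Measure (UnitAddTorus d)).prod volume) :=
    (⟨FunctionSpaces.Torus.measurable_proj, Torus.map_proj_volume_restrict_symCube⟩ :
      MeasurePreserving _ _ _).prod (MeasurePreserving.id (volume : Measure (EuclideanSpace ℝ d)))
  have h2 := measurePreserving_pi
    (fun _ : Fin N => ((volume : Measure (EuclideanSpace ℝ d)).restrict (Torus.symCube d)).prod volume)
    (fun _ : Fin N => (volume : Measure (UnitAddTorus d × EuclideanSpace ℝ d)))
    (hν := fun _ => inferInstance) (fun _ => h1)
  rw [← volume_restrict_chartCube] at h2
  exact h2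

/-- The projection is measurable. [folklore] -/
theorem measurable_projConfig :
    Measurable (projConfig : Config N d (EuclideanSpace ℝ d) → Config N d (UnitAddTorus d)) :=
  measurable_pi_lambda _ fun i =>
    (FunctionSpaces.Torus.measurable_proj.comp (measurable_pi_apply i).fst).prodMk
      (measurable_pi_apply i).snd

/-- **The lift is measure preserving from the torus phase space to the chart cube**
(`Torus.measurePreserving_reprSym`, one particle at a time). [folklore] -/
theorem measurePreserving_reprConfig :
    MeasurePreserving (reprConfig : Config N d (UnitAddTorus d) → Config N d (EuclideanSpace ℝ d))
      volume (volume.restrict (chartCube N d)) := by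
  have h1 : MeasurePreserving
      (Prod.map (Torus.reprSym : UnitAddTorus d → EuclideanSpace ℝ d) id)
      ((volume : Measure (UnitAddTorus d)).prod volume)
      (((volume : Measure (EuclideanSpace ℝ d)).restrict (Torus.symCube d)).prod volume) :=
    Torus.measurePreserving_reprSym.prod (MeasurePreserving.id (volume : Measure (EuclideanSpace ℝ d)))
  have h2 := measurePreserving_pi
    (fun _ : Fin N => (volume : Measure (UnitAddTorus d × EuclideanSpace ℝ d)))
    (fun _ : Fin N => ((volume : Measure (EuclideanSpace ℝ d)).restrict (Torus.symCube d)).prod volume)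
    (hν := fun _ => inferInstance) (fun _ => h1)
  rw [← volume_restrict_chartCube] at h2
  exact h2

/-- In the chart, the lift inverts the projection: `reprConfig (projConfig z) = z` if all
positions of `z` have norm `< 1/2`. [folklore] -/
theorem reprConfig_projConfig {z : Config N d (EuclideanSpace ℝ d)} (hz : ∀ i, ‖(z i).1‖ < 1 / 2) :
    reprConfig (projConfig z) = z := by
  funext i
  simp only [reprConfig, projConfig, Torus.reprSym_proj_of_norm_lt (hz i)]

/-- **Volume of lifted sets**: `vol_T (reprConfig ⁻¹' Y) ≤ vol_E (Y)`. [folklore] -/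
theorem volume_preimage_reprConfig_le (Y : Set (Config N d (EuclideanSpace ℝ d))) :
    volume (reprConfig ⁻¹' Y : Set (Config N d (UnitAddTorus d))) ≤ volume Y :=
  calc volume (reprConfig ⁻¹' Y : Set (Config N d (UnitAddTorus d)))
      ≤ Measure.map reprConfig volume Y :=
        Measure.le_map_apply measurePreserving_reprConfig.measurable.aemeasurable Y
    _ = volume.restrict (chartCube N d) Y := by rw [measurePreserving_reprConfig.map_eq]
    _ ≤ volume Y := Measure.restrict_le_self Y

/-- **Volume of the transfer map's preimages**: for `L > 0` and a set `K` of configurations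
that the rescaling `z ↦ L⁻¹ z` maps into the chart cube,
`vol_E (K ∩ (P ∘ L⁻¹)⁻¹ S) ≤ L^{dim} vol_T (S)` for every `S`. [folklore] -/
theorem volume_inter_preimage_transfer_le {L : ℝ} (hL : 0 < L) {K : Set (Config N d (EuclideanSpace ℝ d))}
    (hK : ∀ z ∈ K, L⁻¹ • z ∈ chartCube N d) (S : Set (Config N d (UnitAddTorus d))) :
    volume (K ∩ (fun z => projConfig (L⁻¹ • z)) ⁻¹' S) ≤
      ENNReal.ofReal (L ^ Module.finrank ℝ (Config N d (EuclideanSpace ℝ d))) * volume S := by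
  have hsub : K ∩ (fun z => projConfig (L⁻¹ • z)) ⁻¹' S ⊆
      (fun z : Config N d (EuclideanSpace ℝ d) => L⁻¹ • z) ⁻¹' (chartCube N d ∩ projConfig ⁻¹' S) :=
    fun z hz => ⟨hK z hz.1, hz.2⟩
  refine (measure_mono hsub).trans ?_
  haveI := Euclidean.isAddHaarMeasure_volume_config (d := d) (N := N)
  rw [Measure.addHaar_preimage_smul _ (inv_ne_zero hL.ne'), inv_pow, inv_inv,
    abs_of_nonneg (pow_nonneg hL.le _)]
  gcongr
  calc volume (chartCube N d ∩ projConfig ⁻¹' S)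
      = volume.restrict (chartCube N d) (projConfig ⁻¹' S) := by
        rw [Measure.restrict_apply' measurableSet_chartCube, inter_comm]
    _ ≤ Measure.map projConfig (volume.restrict (chartCube N d)) S :=
        Measure.le_map_apply measurePreserving_projConfig.measurable.aemeasurable S
    _ = volume S := by rw [measurePreserving_projConfig.map_eq]

/-- Every configuration lies in the box of some natural radius. [folklore] -/
theorem exists_mem_phaseBox_nat (z : Config N d (EuclideanSpace ℝ d)) : ∃ n : ℕ, z ∈ phaseBox N d n := by
  obtain ⟨n, hn⟩ := exists_nat_ge (∑ i, (‖(z i).1‖ + ‖(z i).2‖))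
  refine ⟨n, fun i => ⟨le_trans ?_ hn, le_trans ?_ hn⟩⟩
  · exact le_trans (le_add_of_nonneg_right (norm_nonneg _))
      (Finset.single_le_sum (f := fun i => ‖(z i).1‖ + ‖(z i).2‖) (fun _ _ => by positivity)
        (Finset.mem_univ i))
  · exact le_trans (le_add_of_nonneg_left (norm_nonneg _))
      (Finset.single_le_sum (f := fun i => ‖(z i).1‖ + ‖(z i).2‖) (fun _ _ => by positivity)
        (Finset.mem_univ i))

/-- The boxes of natural radii increase. [folklore] -/
theorem monotone_phaseBox_nat : Monotone fun n : ℕ => phaseBox N d (n : ℝ) := by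
  intro a b hab z hz i
  have h : (a : ℝ) ≤ b := Nat.cast_le.2 hab
  exact ⟨(hz i).1.trans h, (hz i).2.trans h⟩

/-- The kinetic energy on the box of radius `R` is at most `N R² / 2`. [folklore] -/
theorem configEnergy_le_of_mem_phaseBox {R : ℝ} {z : Config N d (EuclideanSpace ℝ d)}
    (hz : z ∈ phaseBox N d R) : configEnergy z ≤ N * R ^ 2 / 2 := by
  unfold configEnergy
  have h : ∑ i, ‖(z i).2‖ ^ 2 ≤ N * R ^ 2 := by
    calc ∑ i, ‖(z i).2‖ ^ 2 ≤ ∑ _i : Fin N, R ^ 2 :=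
          Finset.sum_le_sum fun i _ => pow_le_pow_left₀ (norm_nonneg _) (hz i).2 2
      _ = N * R ^ 2 := by simp
  linarith

/-- **Rescaled box data are chart-safe**: if `4R(1 + (T+1)√N) < L` then `L⁻¹ z` is chart-safe
for the horizon `T` for every `z` in the box of radius `R`. [folklore] -/
theorem isChartSafe_smul_of_mem_phaseBox {R T L : ℝ} (hR : 0 ≤ R) (hT : 0 ≤ T)
    (hL : 4 * R * (1 + (T + 1) * Real.sqrt N) < L) {z : Config N d (EuclideanSpace ℝ d)}
    (hz : z ∈ phaseBox N d R) : IsChartSafe T (L⁻¹ • z) := by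
  have hN : 0 ≤ Real.sqrt N := Real.sqrt_nonneg _
  have hL0 : 0 < L := lt_of_le_of_lt (by positivity) hL
  refine ⟨R / L, R * Real.sqrt N / L, by positivity, fun i => ?_, ?_, ?_⟩
  · rw [smul_config_fst, norm_smul, Real.norm_eq_abs, abs_of_pos (inv_pos.2 hL0), div_eq_inv_mul]
    exact mul_le_mul_of_nonneg_left (hz i).1 (inv_pos.2 hL0).le
  · rw [configEnergy_smul]
    have hE := configEnergy_le_of_mem_phaseBox hz
    have hsq : Real.sqrt N ^ 2 = N := Real.sq_sqrt (Nat.cast_nonneg N)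
    calc L⁻¹ ^ 2 * configEnergy z ≤ L⁻¹ ^ 2 * (N * R ^ 2 / 2) :=
          mul_le_mul_of_nonneg_left hE (by positivity)
      _ = (R * Real.sqrt N / L) ^ 2 / 2 := by rw [div_pow, mul_pow, hsq]; field_simp
  · have h : R / L + (T + 1) * (R * Real.sqrt N / L) = (4 * R * (1 + (T + 1) * Real.sqrt N)) / L * 4⁻¹ := by
      field_simp
    rw [h]
    have h2 : (4 * R * (1 + (T + 1) * Real.sqrt N)) / L < 1 := (div_lt_one hL0).2 hL
    linarith

/-- Rescaled box data lie in the chart cube (positions of norm `≤ R/L < 1/2`). [folklore] -/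
theorem smul_mem_chartCube_of_mem_phaseBox {R L : ℝ} (hR : 0 ≤ R) (hL : 2 * R < L)
    {z : Config N d (EuclideanSpace ℝ d)} (hz : z ∈ phaseBox N d R) : L⁻¹ • z ∈ chartCube N d := by
  have hL0 : 0 < L := by linarith
  refine mem_chartCube_of_norm_lt fun i => ?_
  rw [smul_config_fst, norm_smul, Real.norm_eq_abs, abs_of_pos (inv_pos.2 hL0)]
  calc L⁻¹ * ‖(z i).1‖ ≤ L⁻¹ * R := mul_le_mul_of_nonneg_left (hz i).1 (inv_pos.2 hL0).le
    _ < 1 / 2 := by rw [inv_mul_lt_iff₀ hL0]; linarith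

/-- Rescaled box data have positions of norm `< 1/2`. [folklore] -/
theorem norm_fst_smul_lt_of_mem_phaseBox {R L : ℝ} (hL : 2 * R < L) (hL0 : 0 < L)
    {z : Config N d (EuclideanSpace ℝ d)} (hz : z ∈ phaseBox N d R) (i : Fin N) :
    ‖((L⁻¹ • z) i).1‖ < 1 / 2 := by
  rw [smul_config_fst, norm_smul, Real.norm_eq_abs, abs_of_pos (inv_pos.2 hL0)]
  calc L⁻¹ * ‖(z i).1‖ ≤ L⁻¹ * R := mul_le_mul_of_nonneg_left (hz i).1 (inv_pos.2 hL0).le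
    _ < 1 / 2 := by rw [inv_mul_lt_iff₀ hL0]; linarith

end Alexander

end MeasureTransfer

/-! ## Alexander's theorem and Liouville's theorem in `ℝ^d` -/

section EuclidAlexander

variable {d : Type*} [Fintype d] {N : ℕ}

namespace Alexander

variable {ε : ℝ}

/-- A scale `L` large enough for the box of radius `R`, the horizon `T` and the diameter `ε`. [folklore] -/
theorem exists_scale (ε R T : ℝ) (N : ℕ) :
    ∃ L : ℝ, 0 < L ∧ 4 * R * (1 + (T + 1) * Real.sqrt N) < L ∧ 2 * R < L ∧ 2 * ε < L := by
  refine ⟨|4 * R * (1 + (T + 1) * Real.sqrt N)| + |2 * R| + |2 * ε| + 1, by positivity, ?_, ?_, ?_⟩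
  · linarith [le_abs_self (4 * R * (1 + (T + 1) * Real.sqrt N)), abs_nonneg (2 * R), abs_nonneg (2 * ε)]
  · linarith [abs_nonneg (4 * R * (1 + (T + 1) * Real.sqrt N)), le_abs_self (2 * R), abs_nonneg (2 * ε)]
  · linarith [abs_nonneg (4 * R * (1 + (T + 1) * Real.sqrt N)), abs_nonneg (2 * R), le_abs_self (2 * ε)]

/-- The rescaled diameter `ε/L` is in `(0, 1/2)`. [folklore] -/
theorem scaled_diameter {L : ℝ} (hε : 0 < ε) (hL0 : 0 < L) (hL : 2 * ε < L) :
    0 < L⁻¹ * ε ∧ L⁻¹ * ε < 2⁻¹ := by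
  refine ⟨mul_pos (inv_pos.2 hL0) hε, ?_⟩
  rw [inv_mul_lt_iff₀ hL0]
  linarith

/-- **The Euclidean bad set is null on boxes, horizon by horizon**: the data of the box of
radius `R` that lie in the domain but not in the truncated good set `Γ₀^E(T)` form a null set —
they are carried by the transfer map `P ∘ L⁻¹` into the Liouville-null bad set of the torus
(`torusFlow_ae_good_holds`). [cite: GST2013, Prop. 4.1.1 p. 19] -/
theorem euclid_volume_phaseBox_inter_diff_goodUpTo (hε : 0 < ε) {R : ℝ} (hR : 0 ≤ R) {T : ℝ} (hT : 0 ≤ T) :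
    volume (phaseBox N d R ∩ (hardSphereDomain (Euclidean.geometry d) N ε \
      goodUpTo (Euclidean.geometry d) ε T)) = 0 := by
  obtain ⟨L, hL0, hL1, hL2, hL3⟩ := exists_scale ε R T N
  obtain ⟨hε'0, hε'1⟩ := scaled_diameter hε hL0 hL3
  have hGT := Torus.isHardSphereRegular_geometry (d := d) hε'1
  have hGTm : (Torus.geometry d).IsMeasurable := Torus.isMeasurable_geometry
  have hbadT : volume (hardSphereDomain (Torus.geometry d) N (L⁻¹ * ε) \
      good (Torus.geometry d) (L⁻¹ * ε)) = 0 := by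
    have h := torusFlow_ae_good_holds (d := d) hε'0 hε'1 N
    rw [liouville_eq, Measure.restrict_apply (measurableSet_good hGT hGTm).compl] at h
    rwa [Set.sdiff_eq, inter_comm]
  have hsub : phaseBox N d R ∩ (hardSphereDomain (Euclidean.geometry d) N ε \
      goodUpTo (Euclidean.geometry d) ε T) ⊆ phaseBox N d R ∩
        (fun z => projConfig (L⁻¹ • z)) ⁻¹' (hardSphereDomain (Torus.geometry d) N (L⁻¹ * ε) \
          good (Torus.geometry d) (L⁻¹ * ε)) := by
    rintro z ⟨hzK, hzD, hzg⟩
    have hsafe : IsChartSafe T (L⁻¹ • z) := isChartSafe_smul_of_mem_phaseBox hR hT hL1 hzK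
    refine ⟨hzK, ?_, fun hg => hzg ?_⟩
    · exact (projConfig_mem_hardSphereDomain_iff (hsafe.norm_fst_lt hT)).2
        ((smul_mem_hardSphereDomain_iff (inv_pos.2 hL0)).2 hzD)
    · have h1 := good_subset_goodUpTo T hg
      rwa [hsafe.projConfig_mem_goodUpTo_iff hT, smul_mem_goodUpTo_iff (inv_pos.2 hL0)] at h1
  refine measure_mono_null hsub (nonpos_iff_eq_zero.1 ?_)
  calc volume (phaseBox N d R ∩ (fun z => projConfig (L⁻¹ • z)) ⁻¹'
        (hardSphereDomain (Torus.geometry d) N (L⁻¹ * ε) \ good (Torus.geometry d) (L⁻¹ * ε)))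
      ≤ ENNReal.ofReal (L ^ Module.finrank ℝ (Config N d (EuclideanSpace ℝ d))) *
          volume (hardSphereDomain (Torus.geometry d) N (L⁻¹ * ε) \
            good (Torus.geometry d) (L⁻¹ * ε)) :=
        volume_inter_preimage_transfer_le hL0
          (fun z hz => smul_mem_chartCube_of_mem_phaseBox hR hL2 hz) _
    _ = 0 := by rw [hbadT, mul_zero]

/-- **The Euclidean bad set is null.** [cite: GST2013, Prop. 4.1.1 p. 19] -/
theorem euclid_volume_hardSphereDomain_diff_good (hε : 0 < ε) :
    volume (hardSphereDomain (Euclidean.geometry d) N ε \ good (Euclidean.geometry d) ε) = 0 := by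
  have hcov : hardSphereDomain (Euclidean.geometry d) N ε \ good (Euclidean.geometry d) ε ⊆
      ⋃ n : ℕ, ⋃ R : ℕ, phaseBox N d R ∩ (hardSphereDomain (Euclidean.geometry d) N ε \
        goodUpTo (Euclidean.geometry d) ε n) := by
    rintro z ⟨hzD, hzg⟩
    rw [good_eq_iInter_goodUpTo, mem_iInter] at hzg
    obtain ⟨n, hn⟩ := not_forall.1 hzg
    obtain ⟨R, hR⟩ := exists_mem_phaseBox_nat z
    exact mem_iUnion.2 ⟨n, mem_iUnion.2 ⟨R, hR, hzD, hn⟩⟩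
  exact measure_mono_null hcov (measure_iUnion_null fun n => measure_iUnion_null fun R =>
    euclid_volume_phaseBox_inter_diff_goodUpTo hε (Nat.cast_nonneg R) (Nat.cast_nonneg n))

variable (N) in
/-- **Alexander's theorem in `ℝ^d`** (Alexander 1975; GST 2013 Prop. 4.1.1: "Let `N, ε` be
fixed. The set of initial configurations leading to a pathological trajectory is of measure zero
in `ℝ^{2dN}`"; CIP 1994 Thm. 4.2.1 and App. 4.A p. 111: "the case `Λ = ℝ³` can be treated
similarly"): for `ε > 0` the complement of the good set `Γ₀` of the collision-by-collision flow
on `(ℝ^d × ℝ^d)^N` is Liouville-null. [cite: GST2013, Prop. 4.1.1 p. 19] -/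
theorem euclidFlow_ae_good (hε : 0 < ε) :
    liouville (Euclidean.geometry d) N ε (good (Euclidean.geometry d) ε)ᶜ = 0 := by
  have hG := Euclidean.isHardSphereRegular_geometry (d := d) ε
  have hGm : (Euclidean.geometry d).IsMeasurable := Euclidean.isMeasurable_geometry
  rw [liouville_eq, Measure.restrict_apply (measurableSet_good (N := N) hG hGm).compl, inter_comm,
    ← Set.sdiff_eq]
  exact euclid_volume_hardSphereDomain_diff_good hε

/-- **Transfer of one orbit**: for a good datum `z` of the box of radius `R` whose image
`T^s z` lies in the box and in `B`, the torus orbit of `P (L⁻¹ z)` at time `s` lies in the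
lifted rescaled copy `reprConfig ⁻¹' (L⁻¹ B)` of `B`, and `P (L⁻¹ z)` lies in the torus domain
of diameter `ε / L` (scale `L` adapted to `R`, `|s|`). [folklore] -/
theorem euclid_transfer_orbit {L s R : ℝ} (hR : 0 ≤ R) (hL0 : 0 < L)
    (hL1 : 4 * R * (1 + (|s| + 1) * Real.sqrt N) < L) (hL2 : 2 * R < L)
    {z : Config N d (EuclideanSpace ℝ d)} (hzg : z ∈ good (Euclidean.geometry d) ε)
    (hzK : z ∈ phaseBox N d R) (hzK' : flow (Euclidean.geometry d) ε s z ∈ phaseBox N d R)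
    {B : Set (Config N d (EuclideanSpace ℝ d))} (hzB : flow (Euclidean.geometry d) ε s z ∈ B) :
    flow (Torus.geometry d) (L⁻¹ * ε) s (projConfig (L⁻¹ • z)) ∈
        (reprConfig ⁻¹' ((fun w : Config N d (EuclideanSpace ℝ d) => L • w) ⁻¹' B) :
          Set (Config N d (UnitAddTorus d))) ∧
      projConfig (L⁻¹ • z) ∈ hardSphereDomain (Torus.geometry d) N (L⁻¹ * ε) := by
  have hsafe : IsChartSafe |s| (L⁻¹ • z) :=
    isChartSafe_smul_of_mem_phaseBox hR (abs_nonneg s) hL1 hzK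
  refine ⟨?_, ?_⟩
  · rw [mem_preimage, mem_preimage, ← hsafe.projConfig_flow (abs_nonneg s) le_rfl,
      flow_smul (inv_pos.2 hL0), reprConfig_projConfig (norm_fst_smul_lt_of_mem_phaseBox hL2 hL0 hzK'),
      smul_smul, mul_inv_cancel₀ hL0.ne', one_smul]
    exact hzB
  · exact (projConfig_mem_hardSphereDomain_iff (hsafe.norm_fst_lt (abs_nonneg s))).2
      ((smul_mem_hardSphereDomain_iff (inv_pos.2 hL0)).2 (good_subset_hardSphereDomain hzg))

/-- **Sub-invariance of `vol|_{Γ₀}` in `ℝ^d`, on boxes**: for real `s`, measurable `B` and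
`R ≥ 0`, the good data of the box of radius `R` that `T^s` maps into `B` and into the box have
volume `≤ vol B`: they are carried by the transfer map `P ∘ L⁻¹` to torus data that the torus
flow maps into the lifted rescaled copy of `B` (`euclid_transfer_orbit`), the torus flow
preserves the Liouville measure (`torusFlow_measurePreserving_holds`), and the transfer map
multiplies volumes by `L^{-2dN}` both ways. [cite: GST2013, proof of Prop. 4.1.1 p. 19] -/
theorem euclid_volume_good_inter_preimage_flow_box_le (hε : 0 < ε) (s : ℝ)
    {B : Set (Config N d (EuclideanSpace ℝ d))} (hB : MeasurableSet B) {R : ℝ} (hR : 0 ≤ R) :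
    volume (good (Euclidean.geometry d) ε ∩ flow (Euclidean.geometry d) ε s ⁻¹' B ∩
      (phaseBox N d R ∩ flow (Euclidean.geometry d) ε s ⁻¹' phaseBox N d R)) ≤ volume B := by
  obtain ⟨L, hL0, hL1, hL2, hL3⟩ := exists_scale ε R |s| N
  obtain ⟨hε'0, hε'1⟩ := scaled_diameter hε hL0 hL3
  have hGT := Torus.isHardSphereRegular_geometry (d := d) hε'1
  have hGTm : (Torus.geometry d).IsMeasurable := Torus.isMeasurable_geometry
  have hS'm : MeasurableSet (reprConfig ⁻¹' ((fun w : Config N d (EuclideanSpace ℝ d) => L • w) ⁻¹' B) :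
      Set (Config N d (UnitAddTorus d))) :=
    (hB.preimage (measurable_const_smul L)).preimage measurePreserving_reprConfig.measurable
  have hsub : good (Euclidean.geometry d) ε ∩ flow (Euclidean.geometry d) ε s ⁻¹' B ∩
      (phaseBox N d R ∩ flow (Euclidean.geometry d) ε s ⁻¹' phaseBox N d R) ⊆
      phaseBox N d R ∩ (fun z => projConfig (L⁻¹ • z)) ⁻¹'
        (flow (Torus.geometry d) (L⁻¹ * ε) s ⁻¹'
          (reprConfig ⁻¹' ((fun w : Config N d (EuclideanSpace ℝ d) => L • w) ⁻¹' B)) ∩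
          hardSphereDomain (Torus.geometry d) N (L⁻¹ * ε)) := by
    rintro z ⟨⟨hzg, hzB⟩, hzK, hzK'⟩
    exact ⟨hzK, euclid_transfer_orbit hR hL0 hL1 hL2 hzg hzK hzK' hzB⟩
  refine (measure_mono hsub).trans ?_
  refine (volume_inter_preimage_transfer_le hL0
    (fun z hz => smul_mem_chartCube_of_mem_phaseBox hR hL2 hz) _).trans ?_
  rw [← Measure.restrict_apply (measurable_flow hGT hGTm s hS'm), ← liouville_eq,
    (torusFlow_measurePreserving_holds hε'0 hε'1 N s).measure_preimage hS'm.nullMeasurableSet,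
    liouville_eq]
  calc ENNReal.ofReal (L ^ Module.finrank ℝ (Config N d (EuclideanSpace ℝ d))) *
        volume.restrict (hardSphereDomain (Torus.geometry d) N (L⁻¹ * ε))
          (reprConfig ⁻¹' ((fun w : Config N d (EuclideanSpace ℝ d) => L • w) ⁻¹' B))
      ≤ ENNReal.ofReal (L ^ Module.finrank ℝ (Config N d (EuclideanSpace ℝ d))) *
          volume (reprConfig ⁻¹' ((fun w : Config N d (EuclideanSpace ℝ d) => L • w) ⁻¹' B) :
            Set (Config N d (UnitAddTorus d))) := by
        gcongr
        exact Measure.restrict_le_self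
    _ ≤ ENNReal.ofReal (L ^ Module.finrank ℝ (Config N d (EuclideanSpace ℝ d))) *
          volume ((fun w : Config N d (EuclideanSpace ℝ d) => L • w) ⁻¹' B) := by
        gcongr
        exact volume_preimage_reprConfig_le _
    _ = volume B := by
        haveI := Euclidean.isAddHaarMeasure_volume_config (d := d) (N := N)
        rw [Measure.addHaar_preimage_smul _ hL0.ne', ← mul_assoc,
          abs_of_nonneg (inv_nonneg.2 (pow_nonneg hL0.le _)),
          ← ENNReal.ofReal_mul (pow_nonneg hL0.le _), mul_inv_cancel₀ (pow_ne_zero _ hL0.ne'),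
          ENNReal.ofReal_one, one_mul]

/-- **Sub-invariance of `vol|_{Γ₀}` in `ℝ^d`**: for every real `s` and measurable `B`,
`vol (Γ₀ ∩ (T^s)⁻¹ B) ≤ vol B` (exhaustion by boxes of `euclid_volume_good_inter_preimage_flow_box_le`).
[cite: GST2013, proof of Prop. 4.1.1 p. 19] -/
theorem euclid_volume_good_inter_preimage_flow_le (hε : 0 < ε) (s : ℝ)
    {B : Set (Config N d (EuclideanSpace ℝ d))} (hB : MeasurableSet B) :
    volume (good (Euclidean.geometry d) ε ∩ flow (Euclidean.geometry d) ε s ⁻¹' B) ≤ volume B := by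
  have hA : good (Euclidean.geometry d) ε ∩ flow (Euclidean.geometry d) ε s ⁻¹' B =
      ⋃ R : ℕ, good (Euclidean.geometry d) ε ∩ flow (Euclidean.geometry d) ε s ⁻¹' B ∩
        (phaseBox N d R ∩ flow (Euclidean.geometry d) ε s ⁻¹' phaseBox N d R) := by
    ext z
    simp only [mem_iUnion, mem_inter_iff, mem_preimage]
    constructor
    · intro hz
      obtain ⟨R₁, h₁⟩ := exists_mem_phaseBox_nat z
      obtain ⟨R₂, h₂⟩ := exists_mem_phaseBox_nat (flow (Euclidean.geometry d) ε s z)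
      exact ⟨max R₁ R₂, hz, monotone_phaseBox_nat (le_max_left _ _) h₁,
        monotone_phaseBox_nat (le_max_right _ _) h₂⟩
    · rintro ⟨R, hz, -⟩
      exact hz
  have hmono : Monotone fun R : ℕ =>
      good (Euclidean.geometry d) ε ∩ flow (Euclidean.geometry d) ε s ⁻¹' B ∩
        (phaseBox N d R ∩ flow (Euclidean.geometry d) ε s ⁻¹' phaseBox N d R) :=
    fun a b hab z hz => ⟨hz.1, monotone_phaseBox_nat hab hz.2.1, monotone_phaseBox_nat hab hz.2.2⟩
  rw [hA, hmono.measure_iUnion]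
  exact iSup_le fun R => euclid_volume_good_inter_preimage_flow_box_le hε s hB (Nat.cast_nonneg R)

/-- **Invariance of `vol|_{Γ₀}` under `T^s` in `ℝ^d`** for every real `s`: sub-invariance at
times `s` and `-s` and the group property on `Γ₀` (`HardSphereFlowGroup`). [cite: CIP1994, §4.2 (2.3)] -/
theorem euclid_volume_good_inter_preimage_flow_eq (hε : 0 < ε) (s : ℝ)
    {B : Set (Config N d (EuclideanSpace ℝ d))} (hB : MeasurableSet B) :
    volume (good (Euclidean.geometry d) ε ∩ flow (Euclidean.geometry d) ε s ⁻¹' B) =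
      volume (good (N := N) (Euclidean.geometry d) ε ∩ B) := by
  have hG := Euclidean.isHardSphereRegular_geometry (d := d) ε
  have hGm : (Euclidean.geometry d).IsMeasurable := Euclidean.isMeasurable_geometry
  have hgm : MeasurableSet (good (N := N) (Euclidean.geometry d) ε) := measurableSet_good hG hGm
  have hred : good (Euclidean.geometry d) ε ∩ flow (Euclidean.geometry d) ε s ⁻¹' B =
      good (Euclidean.geometry d) ε ∩ flow (Euclidean.geometry d) ε s ⁻¹' (good (Euclidean.geometry d) ε ∩ B) := by
    ext z
    simp only [mem_inter_iff, mem_preimage]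
    exact ⟨fun h => ⟨h.1, mapsTo_flow_good hG s h.1, h.2⟩, fun h => ⟨h.1, h.2.2⟩⟩
  rw [hred]
  have hB'm : MeasurableSet (good (Euclidean.geometry d) ε ∩ B) := hgm.inter hB
  refine le_antisymm (euclid_volume_good_inter_preimage_flow_le hε s hB'm) ?_
  have hAm : MeasurableSet (good (Euclidean.geometry d) ε ∩
      flow (Euclidean.geometry d) ε s ⁻¹' (good (Euclidean.geometry d) ε ∩ B)) :=
    hgm.inter ((measurable_flow hG hGm s) hB'm)
  have hsub : good (Euclidean.geometry d) ε ∩ B ⊆ good (Euclidean.geometry d) ε ∩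
      flow (Euclidean.geometry d) ε (-s) ⁻¹' (good (Euclidean.geometry d) ε ∩
        flow (Euclidean.geometry d) ε s ⁻¹' (good (Euclidean.geometry d) ε ∩ B)) := by
    intro b hb
    have hbg : b ∈ good (Euclidean.geometry d) ε := hb.1
    refine ⟨hbg, mapsTo_flow_good hG (-s) hbg, ?_⟩
    rw [mem_preimage, ← flow_add_of_mem_good hG s (-s) hbg, add_neg_cancel,
      flow_zero_of_mem_good hG hbg]
    exact hb
  exact (measure_mono hsub).trans (euclid_volume_good_inter_preimage_flow_le hε (-s) hAm)

variable (N) in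
/-- **Liouville's theorem for the hard-sphere flow in `ℝ^d`**: for `ε > 0` each `T^t`
preserves the Liouville measure `dZ|_{D_ε^N}` (CIP 1994 §4.2 and App. 4.A; GST 2013, proof of
Prop. 4.1.1: "the measure is invariant by the flow"). Since `Γ₀ᶜ` is null
(`euclidFlow_ae_good`), `liouville = vol|_{Γ₀}`, which is invariant by
`euclid_volume_good_inter_preimage_flow_eq`. [cite: CIP1994, App. 4.A pp. 107–111] -/
theorem euclidFlow_measurePreserving (hε : 0 < ε) (t : ℝ) :
    MeasurePreserving (flow (Euclidean.geometry d) ε t)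
      (liouville (Euclidean.geometry d) N ε) (liouville (Euclidean.geometry d) N ε) := by
  have hG := Euclidean.isHardSphereRegular_geometry (d := d) ε
  have hGm : (Euclidean.geometry d).IsMeasurable := Euclidean.isMeasurable_geometry
  have hgood : MeasurableSet (good (N := N) (Euclidean.geometry d) ε) := measurableSet_good hG hGm
  have hae : hardSphereDomain (Euclidean.geometry d) N ε =ᵐ[volume] good (Euclidean.geometry d) ε := by
    rw [ae_eq_set]
    refine ⟨euclid_volume_hardSphereDomain_diff_good hε, ?_⟩
    exact measure_mono_null (fun z hz => (hz.2 (good_subset_hardSphereDomain hz.1)).elim)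
      measure_empty
  have hL : liouville (Euclidean.geometry d) N ε = volume.restrict (good (Euclidean.geometry d) ε) := by
    rw [liouville_eq]; exact Measure.restrict_congr_set hae
  refine ⟨measurable_flow hG hGm t, ?_⟩
  rw [hL]
  ext B hB
  rw [Measure.map_apply (measurable_flow hG hGm t) hB,
    Measure.restrict_apply (measurable_flow hG hGm t hB), Measure.restrict_apply hB, inter_comm,
    euclid_volume_good_inter_preimage_flow_eq hε t hB, inter_comm]

end Alexander

/-- **Alexander's theorem in `ℝ^d`** — discharge of the named fact
`Literature.Analysis.FluidPDE.HardSphereFlow.nonempty` (Alexander 1975; Gallagher–Saint-Raymond–Texier 2013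
Prop. 4.1.1, stated in `ℝ^{2dN}`; Cercignani–Illner–Pulvirenti 1994 Thm. 4.2.1, App. 4.A
p. 111): for every `ε > 0` and every `N` the hard-sphere flow on `(ℝ^d × ℝ^d)^N` exists — the
collision-by-collision flow `Alexander.flow` with good set `Alexander.good` is a
measurable group of hard-sphere trajectories (`HardSphereFlowOrbits`, `HardSphereFlowGroup`,
`HardSphereFlowMeasurable`, valid for every regular measurable geometry) on an invariant
Liouville-conull set (`Alexander.euclidFlow_ae_good`) and preserves the Liouville measure
(`Alexander.euclidFlow_measurePreserving`), both obtained from the torus theorems by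
rescaling and projection. [cite: Alexander1975] [cite: GST2013, Prop. 4.1.1 p. 19] -/
theorem HardSphereFlow.nonempty_holds : HardSphereFlow.nonempty (d := d) := by
  intro ε hε N
  have hG := Euclidean.isHardSphereRegular_geometry (d := d) ε
  have hGm : (Euclidean.geometry d).IsMeasurable := Euclidean.isMeasurable_geometry
  exact ⟨{  flow := Alexander.flow (Euclidean.geometry d) ε
            good := Alexander.good (Euclidean.geometry d) ε
            measurableSet_good := Alexander.measurableSet_good hG hGm
            good_subset := Alexander.good_subset_hardSphereDomain
            measure_compl_good := Alexander.euclidFlow_ae_good N hε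
            mapsTo_good := fun t => Alexander.mapsTo_flow_good hG t
            flow_zero := fun z hz => Alexander.flow_zero_of_mem_good hG hz
            flow_add := fun s t z hz => Alexander.flow_add_of_mem_good hG s t hz
            measurable_flow := fun t => Alexander.measurable_flow hG hGm t
            isTrajectory := fun z hz => Alexander.isHardSphereTrajectory_flow hG hz
            measurePreserving := fun t => Alexander.euclidFlow_measurePreserving N hε t }⟩

end EuclidAlexander

end

end Literature.Analysis.FluidPDE
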